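import Literature.NumberTheory.Automorphic.ParallelWeightAdelicCoefficients
import Literature.NumberTheory.Automorphic.IntegralWeightHeckeModuleGL2
import Literature.NumberTheory.DiophantineGeometry.WeylModuleOneRowForms
import HarnessLib

/-!
# The coefficients `V_{(k−2,0)}` of the Bianchi fact are the binary forms `Sym^{k−2}`

Topic `NumberTheory/Automorphic`; namespaces `Literature.NumberTheory.Automorphic.GLnCohomology`
(the coefficient modules of `CuspidalCohomologyGL`) and `Literature.NumberTheory.Automorphic`
(`symWeight` of `BianchiOrdinaryClassicality`).  Definitions with bodies and theorems; no named
fact, no instance, no `sorry`.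

The receptacle of `hidaControl_dominantOrdinaryPoint` has coefficients
`GLnCohomology.coeffRepGL E 2 (symWeight k) = V_{(k−2,0)}(E)`: Weyl's construction
`S_μ(E²) ⊗ det^{λ₁}` for `λ = (k−2, 0)`, i.e. `μ = (k−2)` ONE-ROW and `det⁰`.  The
coefficients-at-`p` model of the tree (`IntegralWeightHeckeModuleGL2`: `SymPow 𝒪 m`, the forms of
degree `m` in `X₀, X₁` with the integral matrix action `symPowAction` by linear substitution) is
`Sym^m`.  This file identifies the two, `GL₂(E)`-equivariantly, for `E` of characteristic zero:

* `lowestEntry_symWeight = 0`, `coeffDegree_symWeight = k − 2`,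
  `coeffPartition_symWeight = Nat.Partition.indiscrete _` (the bookkeeping of `CuspidalCohomologyGL`
  evaluated at `λ = (k−2, 0)`);
* generic adapters (no transport of elements along type equalities is ever needed):
  `weylRepEquivOfEq` (`S_μ ≃ S_{μ'}` for `μ = μ'`), `formRepEquivOfEq` (`Sym^m ≃ Sym^{m'}` for
  `m = m'`), `coeffRepGLEquivWeylRep` (`V_λ ≃ S_{λ−λ_{n−1}}` when `λ_{n−1} = 0`);
* **`symWeightEquiv E k : Representation.Equiv (coeffRepGL E 2 (symWeight k)) (formRep (Fin 2) E (k − 2))`**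
  (through `WeylModuleOneRowForms.weylFormEquiv`, [FultonHarrisGTM129, Thm. 6.3:
  `S_{(d)} V = Sym^d V`]), with `formRep_apply_eq_symPowAction`:
  `formRep (Fin 2) E m g = symPowAction E m g` — so that **`V_{(k−2,0)}(E) ≅ Sym^{k−2}(E²)` with
  `GL₂(E)` acting by `IntegralWeightGL2.symPowAction`**, the action used by the independence-of-weight
  files (`SymPowOrdinaryLine`, `SymPowIwahoriCoefficients`, `HidaIndependenceOfWeight*`).

## References

* W. Fulton, J. Harris, *Representation Theory*, GTM 129 (1991), §6.1 Thm. 6.3, §15.5.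
  [FultonHarrisGTM129]
* H. Hida, *p-adic ordinary Hecke algebras for GL(2)*, Ann. Inst. Fourier 44 (1994), §1
  (`L(n; A)`, the symmetric `n`-th tensor representation). [Hida1994AIF]
-/

noncomputable section

open scoped BigOperators TensorProduct
open MvPolynomial

namespace Literature.NumberTheory.Automorphic

open Literature.NumberTheory.DiophantineGeometry Literature.Computability.AlgebraicComplexity

/-! ### Bookkeeping: `λ = (k − 2, 0)` -/

section Bookkeeping

variable (k : ℕ)

/-- `λ₁ = 0` for `λ = (k−2, 0)`. [folklore] -/
@[simp]
theorem lowestEntry_symWeight : GLnCohomology.lowestEntry (symWeight k) = 0 := by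
  rw [GLnCohomology.lowestEntry_succ]
  rfl

/-- The first shifted entry of `(k−2, 0)` is `k − 2`. [folklore] -/
@[simp]
theorem polyShift_symWeight_zero : GLnCohomology.polyShift (symWeight k) 0 = k - 2 := by
  rw [GLnCohomology.polyShift, lowestEntry_symWeight, sub_zero]
  change (((k : ℤ) - 2)).toNat = k - 2
  omega

/-- The second shifted entry of `(k−2, 0)` is `0`. [folklore] -/
@[simp]
theorem polyShift_symWeight_one : GLnCohomology.polyShift (symWeight k) 1 = 0 := by
  rw [GLnCohomology.polyShift, lowestEntry_symWeight, sub_zero]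
  rfl

/-- **`d = k − 2`**: the polynomial part of `(k−2, 0)` has size `k − 2`. [folklore] -/
@[simp]
theorem coeffDegree_symWeight : GLnCohomology.coeffDegree (symWeight k) = k - 2 := by
  rw [GLnCohomology.coeffDegree, Fin.sum_univ_two, polyShift_symWeight_zero, polyShift_symWeight_one,
    add_zero]

/-- Two partitions of (a number equal to) zero are equal. [folklore] -/
theorem _root_.Nat.Partition.eq_of_eq_zero {n : ℕ} (hn : n = 0) (p q : Nat.Partition n) : p = q := by
  subst hn
  exact Subsingleton.elim p q

/-- **`μ = (k − 2)` is the one-row partition**: `coeffPartition (symWeight k) = indiscrete (k−2)`.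
[folklore] -/
theorem coeffPartition_symWeight :
    GLnCohomology.coeffPartition (symWeight k) =
      Nat.Partition.indiscrete (GLnCohomology.coeffDegree (symWeight k)) := by
  by_cases h0 : GLnCohomology.coeffDegree (symWeight k) = 0
  · exact Nat.Partition.eq_of_eq_zero h0 _ _
  · refine Nat.Partition.ext ?_
    rw [Nat.Partition.indiscrete_parts h0, GLnCohomology.coeffPartition_parts, coeffDegree_symWeight]
    rw [coeffDegree_symWeight] at h0
    rw [Fin.univ_val_map]
    simp [h0]

end Bookkeeping

/-! ### Adapters: equal partitions, equal degrees, trivial determinant twist -/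

namespace GLnCohomology

section Adapters

variable (E : Type) [Field E]

/-- `S_μ(E^σ) ≃ S_{μ'}(E^σ)` as representations, for `μ = μ'` (identity on tensors). [folklore] -/
def weylRepEquivOfEq {σ : Type*} [Fintype σ] [LinearOrder σ] {d : ℕ} {μ μ' : Nat.Partition d}
    (h : μ = μ') : Representation.Equiv (weylRep E σ μ) (weylRep E σ μ') := by
  subst h
  exact Representation.Equiv.refl _

/-- Unfolding lemma: `weylRepEquivOfEq` is the identity on tensors. [folklore] -/
@[simp]
theorem coe_weylRepEquivOfEq_apply {σ : Type*} [Fintype σ] [LinearOrder σ] {d : ℕ}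
    {μ μ' : Nat.Partition d} (h : μ = μ') (x : weylModule E σ μ) :
    ((weylRepEquivOfEq E h x : weylModule E σ μ') : TensorPower E d (σ → E)) = x := by
  subst h
  rfl

/-- `formRep` acts by `linSubst` on the underlying polynomial (unfolding lemma). [folklore] -/
theorem coe_formRep_apply {σ : Type*} [Fintype σ] [DecidableEq σ] {R : Type*} [CommRing R] (m : ℕ)
    (g : GL σ R) (f : homogeneousSubmodule σ R m) :
    ((formRep σ R m g f : homogeneousSubmodule σ R m) : MvPolynomial σ R) = linSubst σ R (g : Matrix σ σ R) f :=
  rfl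

/-- `Sym^m ≃ Sym^{m'}` (forms of degree `m`, `formRep`) as representations, for `m = m'` (identity
on polynomials). [folklore] -/
def formRepEquivOfEq {σ : Type*} [Fintype σ] [DecidableEq σ] {m m' : ℕ} (h : m = m') :
    Representation.Equiv (formRep σ E m) (formRep σ E m') :=
  Representation.Equiv.mk
    (LinearEquiv.ofEq (homogeneousSubmodule σ E m) (homogeneousSubmodule σ E m')
      (congrArg (homogeneousSubmodule σ E) h)) fun g =>
    LinearMap.ext fun x => Subtype.ext (by
      simp only [LinearMap.coe_comp, Function.comp_apply, LinearEquiv.coe_coe,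
        LinearEquiv.coe_ofEq_apply, coe_formRep_apply])

/-- Unfolding lemma: `formRepEquivOfEq` is the identity on polynomials. [folklore] -/
@[simp]
theorem coe_formRepEquivOfEq_apply {σ : Type*} [Fintype σ] [DecidableEq σ] {m m' : ℕ} (h : m = m')
    (x : homogeneousSubmodule σ E m) :
    ((formRepEquivOfEq E h x : homogeneousSubmodule σ E m') : MvPolynomial σ E) = x :=
  rfl

/-- **`V_λ ≃ S_{λ−λ_{n−1}}` when `λ_{n−1} = 0`** (the determinant twist `det⁰` is trivial): the
identity map from `coeffRepGL E n wt` to the Weyl representation `weylRep E (Fin n) (coeffPartition wt)`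
on the same underlying space. [cite: FultonHarrisGTM129, §15.5] -/
def coeffRepGLEquivWeylRep (n : ℕ) (wt : Fin n → ℤ) (h : lowestEntry wt = 0) :
    Representation.Equiv (coeffRepGL E n wt) (weylRep E (Fin n) (coeffPartition wt)) :=
  Representation.Equiv.mk (LinearEquiv.refl E _) fun g => LinearMap.ext fun w => by
    change coeffRepGL E n wt g w = weylRepCoeff E n wt g w
    rw [coeffRepGL_apply, h, zpow_zero, Units.val_one, one_smul]

/-- Unfolding lemma: `coeffRepGLEquivWeylRep` is the identity (`CoeffModule.toWeyl`). [folklore] -/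
@[simp]
theorem coeffRepGLEquivWeylRep_apply (n : ℕ) (wt : Fin n → ℤ) (h : lowestEntry wt = 0)
    (w : CoeffModule E n wt) : coeffRepGLEquivWeylRep E n wt h w = w.toWeyl :=
  rfl

end Adapters

/-! ### `V_{(k−2,0)}(E) ≅ Sym^{k−2}(E²)` -/

section SymWeight

variable (E : Type) [Field E] [CharZero E] (k : ℕ)

/-- **`V_{(k−2,0)}(E) ≅ Sym^{k−2}(E²)` as representations of `GL₂(E)`** (`E` of characteristic
zero): the coefficient representation `coeffRepGL E 2 (symWeight k)` of the Bianchi fact (Weyl's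
construction for the one-row partition `(k−2)`, trivially twisted) is the space of binary forms of
degree `k − 2` with `GL₂(E)` acting by linear substitution (`formRep (Fin 2) E (k−2)`), via
`coeffRepGLEquivWeylRep`, `weylRepEquivOfEq coeffPartition_symWeight`, `weylFormEquiv`
(`S_{(d)} V = Sym^d V`) and `formRepEquivOfEq coeffDegree_symWeight`.
[cite: FultonHarrisGTM129, §6.1 Thm. 6.3 and §15.5] [cite: Hida1994AIF, §1 (L(n; A))] -/
def symWeightEquiv : Representation.Equiv (coeffRepGL E 2 (symWeight k)) (formRep (Fin 2) E (k - 2)) :=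
  (((coeffRepGLEquivWeylRep E 2 (symWeight k) (lowestEntry_symWeight k)).trans
      (weylRepEquivOfEq E (coeffPartition_symWeight k))).trans
      (weylFormEquiv E (coeffDegree (symWeight k)))).trans
    (formRepEquivOfEq E (coeffDegree_symWeight k))

/-- Equivariance of `symWeightEquiv`, pointwise: `Ψ (V_λ(g) w) = formRep g (Ψ w)`. [folklore] -/
theorem symWeightEquiv_coeffRepGL (g : GL (Fin 2) E) (w : CoeffModule E 2 (symWeight k)) :
    symWeightEquiv E k (coeffRepGL E 2 (symWeight k) g w) = formRep (Fin 2) E (k - 2) g (symWeightEquiv E k w) :=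
  LinearMap.congr_fun ((symWeightEquiv E k).isIntertwining' g) w

/-- **`formRep g = symPowAction g`**: on binary forms of degree `m` the representation `formRep` of
`GL₂(E)` (restriction of `linSubstRep`) is the integral matrix action `IntegralWeightGL2.symPowAction`
of the coefficients-at-`p` model at the matrix of `g` (both are linear substitution of variables).
[folklore] -/
theorem formRep_apply_eq_symPowAction {R : Type} [CommRing R] (m : ℕ) (g : GL (Fin 2) R)
    (f : homogeneousSubmodule (Fin 2) R m) :
    formRep (Fin 2) R m g f = IntegralWeightGL2.symPowAction R m (g : Matrix (Fin 2) (Fin 2) R) f :=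
  Subtype.ext rfl

/-- **`Ψ (V_λ(g) w) = symPowAction g (Ψ w)`**: under `symWeightEquiv` the coefficient representation
of the fact is `Sym^{k−2}(E²)` with the action `symPowAction` of the coefficients-at-`p` model.
[cite: Hida1994AIF, §1] -/
theorem symWeightEquiv_coeffRepGL_eq_symPowAction (g : GL (Fin 2) E) (w : CoeffModule E 2 (symWeight k)) :
    symWeightEquiv E k (coeffRepGL E 2 (symWeight k) g w) =
      IntegralWeightGL2.symPowAction E (k - 2) (g : Matrix (Fin 2) (Fin 2) E) (symWeightEquiv E k w) := by
  rw [symWeightEquiv_coeffRepGL, formRep_apply_eq_symPowAction]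

/-- The underlying polynomial of `Ψ w` is the multiplication map `Θ` of the Weyl tensor of `w`.
[folklore] -/
theorem coe_symWeightEquiv_apply (w : CoeffModule E 2 (symWeight k)) :
    ((symWeightEquiv E k w : homogeneousSubmodule (Fin 2) E (k - 2)) : MvPolynomial (Fin 2) E) =
      tensorToPoly (Fin 2) E (coeffDegree (symWeight k)) (w.toWeyl : TensorPower E _ (Fin 2 → E)) := by
  simp only [symWeightEquiv, Representation.Equiv.trans_apply, coe_formRepEquivOfEq_apply,
    weylFormEquiv_apply, coe_weylToForm_apply, coe_weylRepEquivOfEq_apply, coeffRepGLEquivWeylRep_apply]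

end SymWeight

end GLnCohomology

/-! ### The parallel-weight coefficients `⨂_τ V_{(k−2,0)}(E) ≅ ⨂_τ Sym^{k−2}(E²)` -/

namespace ParallelWeight

open BigHeckeGLn _root_.IsDedekindDomain
open scoped _root_.NumberField

variable (E : Type) [Field E] (F : Type) [Field F] (k : ℕ)

/-- **`⨂_{τ : F → E} Sym^{k−2}(E²)`**: the parallel-weight coefficients in the `SymPow` model of the
coefficients-at-`p` files. [cite: Hida1994AIF, §1 (L(n, v; A) = ⊗_σ L(n_σ; A))] -/
abbrev SymCoeffModule : Type :=
  ⨂[E] _τ : (F →+* E), IntegralWeightGL2.SymPow E (k - 2)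

variable [CharZero E] in
/-- **`⨂_τ V_{(k−2,0)}(E) ≃ ⨂_τ Sym^{k−2}(E²)`** (`PiTensorProduct.congr` of `symWeightEquiv` in each
factor). [cite: FultonHarrisGTM129, §6.1 Thm. 6.3] -/
def symCoeffEquiv : CoeffModule E F 2 (symWeight k) ≃ₗ[E] SymCoeffModule E F k :=
  show (⨂[E] _τ : (F →+* E), GLnCohomology.CoeffModule E 2 (symWeight k)) ≃ₗ[E] SymCoeffModule E F k from
    PiTensorProduct.congr fun _ => (GLnCohomology.symWeightEquiv E k).toLinearEquiv

variable [CharZero E] in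
/-- `symCoeffEquiv` on pure tensors. [folklore] -/
@[simp]
theorem symCoeffEquiv_tprod (x : (F →+* E) → GLnCohomology.CoeffModule E 2 (symWeight k)) :
    symCoeffEquiv E F k (PiTensorProduct.tprod E x) =
      PiTensorProduct.tprod E fun τ => GLnCohomology.symWeightEquiv E k (x τ) :=
  PiTensorProduct.congr_tprod _ _

variable [NumberField F] (v : (F →+* E) → HeightOneSpectrum (𝓞 F))
  (φ : ∀ τ : F →+* E, (v τ).adicCompletion F →+* E)

/-- **The action of `GL₂(𝔸_F^∞)` on `⨂_τ Sym^{k−2}(E²)` through the places `v(τ)`** by the matrix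
action `symPowAction` of the coefficients-at-`p` model in each factor:
`g ↦ ⨂_τ symPowAction (GL₂(φ_τ)(g_{v τ}))`. [cite: Hida1994AIF, §1] -/
def symAdelicRep : Representation E (FiniteAdelicGL 2 F) (SymCoeffModule E F k) :=
  (PiTensorProduct.mapMonoidHom (R := E) (s := fun _ : (F →+* E) => IntegralWeightGL2.SymPow E (k - 2))).comp
    (MonoidHom.pi fun τ : F →+* E =>
      (IntegralWeightGL2.symPowAction E (k - 2)).comp
        ((Units.coeHom (Matrix (Fin 2) (Fin 2) E)).comp
          ((Matrix.GeneralLinearGroup.map (φ τ)).comp (localComponent 2 F (v τ)))))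

/-- `symAdelicRep` on pure tensors. [folklore] -/
@[simp]
theorem symAdelicRep_tprod (g : FiniteAdelicGL 2 F) (x : (F →+* E) → IntegralWeightGL2.SymPow E (k - 2)) :
    symAdelicRep E F k v φ g (PiTensorProduct.tprod E x) =
      PiTensorProduct.tprod E fun τ =>
        IntegralWeightGL2.symPowAction E (k - 2)
          ((Matrix.GeneralLinearGroup.map (φ τ) (localComponent 2 F (v τ) g) : GL (Fin 2) E) :
            Matrix (Fin 2) (Fin 2) E) (x τ) := by
  change PiTensorProduct.map _ _ = _
  exact PiTensorProduct.map_tprod _ _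

variable [CharZero E] in
/-- **`symCoeffEquiv` intertwines `adelicCoeffRep` with `symAdelicRep`**: under
`⨂_τ V_{(k−2,0)}(E) ≃ ⨂_τ Sym^{k−2}(E²)` the finite-adelic action on the fact's coefficients is the
factorwise matrix action `symPowAction` of the coefficients-at-`p` model. [cite: Hida1994AIF, §1] -/
theorem symCoeffEquiv_adelicCoeffRep (g : FiniteAdelicGL 2 F) (x : CoeffModule E F 2 (symWeight k)) :
    symCoeffEquiv E F k (adelicCoeffRep E F 2 (symWeight k) v φ g x) =
      symAdelicRep E F k v φ g (symCoeffEquiv E F k x) := by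
  have h : (symCoeffEquiv E F k).toLinearMap ∘ₗ adelicCoeffRep E F 2 (symWeight k) v φ g =
      symAdelicRep E F k v φ g ∘ₗ (symCoeffEquiv E F k).toLinearMap := by
    refine PiTensorProduct.ext (MultilinearMap.ext fun x => ?_)
    change symCoeffEquiv E F k (adelicCoeffRep E F 2 (symWeight k) v φ g (PiTensorProduct.tprod E x)) =
      symAdelicRep E F k v φ g (symCoeffEquiv E F k (PiTensorProduct.tprod E x))
    rw [adelicCoeffRep_apply_tprod, symCoeffEquiv_tprod, symCoeffEquiv_tprod, symAdelicRep_tprod]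
    congr 1
    funext τ
    exact GLnCohomology.symWeightEquiv_coeffRepGL_eq_symPowAction E k _ (x τ)
  exact LinearMap.congr_fun h x

variable (p : ℕ) [Fact p.Prime]

/-- The same for the chosen `p`-adic place data: `symCoeffEquiv` intertwines `padicCoeffRep` with
`symAdelicRep … (padicPlace F p) (padicPlaceHom F p)` (for `E = ℚ̄_p`, given `CharZero`). [folklore] -/
theorem symCoeffEquiv_padicCoeffRep [CharZero (PadicAlgCl p)] (g : FiniteAdelicGL 2 F)
    (x : CoeffModule (PadicAlgCl p) F 2 (symWeight k)) :
    symCoeffEquiv (PadicAlgCl p) F k (padicCoeffRep F 2 (symWeight k) p g x) =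
      symAdelicRep (PadicAlgCl p) F k (padicPlace F p) (padicPlaceHom F p) g
        (symCoeffEquiv (PadicAlgCl p) F k x) :=
  symCoeffEquiv_adelicCoeffRep (PadicAlgCl p) F k (padicPlace F p) (padicPlaceHom F p) g x

end ParallelWeight

end Literature.NumberTheory.Automorphic
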